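import Literature.Analysis.FluidPDE.ChaeWolfDSSWeightedSerrin
import Literature.Analysis.FluidPDE.Seregin2020SingularSetAxis
import HarnessLib

/-!
# Crux `ForcedSymmetry` (stmt-NavierStokesRegularity-4052), line `recurrent-closing`, stub 3a
# `stub_satelliteExclusion`: Chae–Wolf's weighted Serrin estimate for ROTATED discrete self-similarity

Support file (theorems only, `--supports stmt-NavierStokesRegularity-4052`; the same stub is stub 1 of crux
stmt-NavierStokesRegularity-8561's line `birth`).  Lead c6.

The stub's profiles are invariant under ONE similarity `(t, x) ↦ l • R⁻¹ w (l² t) (l R x)` with a factor `l > 1` AND a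
linear isometry `R` (rotated discrete self-similarity, RDSS).  Step 3 of the proof of Chae–Wolf 2017, Thm 1.1
(arXiv:1610.09464, §2 (2.3)–(2.5)) — the weighted Serrin-type estimate
`∫_{−∞}^0 ∫_{1 ≤ |x| < c} |u|^q (−t)^{(q−5)/2} ≤ max(1, c^{q−5}) ∫_{−c²}^{−1} ∫_{ℝ³} |u|^q` — is in the tree for PURE
discrete self-similarity (`ChaeWolfDecay.lintegral_weighted_annulus_le`, hypothesis `IsDiscretelySelfSimilar c u`).  This
file proves it for RDSS fields (pointwise invariance on `t < 0`), for every factor and every isometry: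

* `rdssInv_comp`, `rdssInv_symm`, `exists_rdssInv_zpow` — the pointwise invariances form a group: composing the pairs
  `(m₁, S₁)`, `(m₂, S₂)` gives `(m₁ m₂, S₁ ≫ S₂)`, inverting gives `(m⁻¹, S⁻¹)`, hence for every `k ∈ ℤ` SOME isometry
  `S_k` with the invariance of factor `l^k` (only the existence of `S_k` is used downstream, so no power of `R` is named);
* `setLIntegral_rpow_enorm_rdss_preimage` — the change of variables behind (2.4): for an invariance pair `(γ, S)` and a
  product set `I × D` with `I ⊆ (−∞,0)` and `D` invariant under `S` (e.g. an annulus about the origin, or `ℝ³`),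
  `∫∫_{Φ_γ⁻¹(I × D)} ‖w‖^q = γ^{q−5} ∫∫_{I × D} ‖w‖^q`, `Φ_γ(t, x) = (γ² t, γ x)` (the rotation is absorbed by the
  measure-preserving map `(t, x) ↦ (t, S x)`, under which `Φ_γ⁻¹(I × D)` is invariant);
* `lintegral_weighted_annulus_le_rdss` — (2.5) for RDSS fields;
* `lintegral_strip_sq_lt_top_of_rdss` — finiteness of `∫∫_{(−c⁴,−1] × ℝ³} ‖w‖^q` from that of the period strip
  `(−c², −1] × ℝ³` (the strip of the squared similarity, used with the annulus `1 ≤ |x| < c²`).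

References: D. Chae, J. Wolf, Comm. PDE 42 (2017) = arXiv:1610.09464, §2 Step 3, (2.3)–(2.5) [ChaeWolf2017RemovingDSS].
-/

noncomputable section

-- the summit and its single sub-problem share the name (CONVENTIONS §1), as in every Theorems file
set_option linter.dupNamespace false

open MeasureTheory Set Function Metric Filter Topology
open scoped ENNReal NNReal
open Literature.Analysis.FluidPDE

namespace Summit.NavierStokesRegularity.NavierStokesRegularity.Theorems.SymmetryModuliCountForcedSymmetry

variable {w : ℝ → EuclideanSpace ℝ (Fin 3) → EuclideanSpace ℝ (Fin 3)}

/-! ### The group of pointwise similarity invariances -/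

/-- **Composition of invariances.**  If `w` is invariant on `t < 0` under the similarities `(m₁, S₁)` and `(m₂, S₂)`
(`m • S⁻¹ w (m² t) (m S x) = w(t, x)`), it is invariant under `(m₁ m₂, S₁ ≫ S₂)`. [folklore] -/
theorem rdssInv_comp {m₁ m₂ : ℝ} (hm₁ : 0 < m₁)
    (S₁ S₂ : EuclideanSpace ℝ (Fin 3) ≃ₗᵢ[ℝ] EuclideanSpace ℝ (Fin 3))
    (h₁ : ∀ t < (0 : ℝ), ∀ x : EuclideanSpace ℝ (Fin 3), m₁ • S₁.symm (w (m₁ ^ 2 * t) (m₁ • S₁ x)) = w t x)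
    (h₂ : ∀ t < (0 : ℝ), ∀ x : EuclideanSpace ℝ (Fin 3), m₂ • S₂.symm (w (m₂ ^ 2 * t) (m₂ • S₂ x)) = w t x) :
    ∀ t < (0 : ℝ), ∀ x : EuclideanSpace ℝ (Fin 3),
      (m₁ * m₂) • (S₁.trans S₂).symm (w ((m₁ * m₂) ^ 2 * t) ((m₁ * m₂) • (S₁.trans S₂) x)) = w t x := by
  intro t ht x
  have ht' : m₁ ^ 2 * t < 0 := mul_neg_of_pos_of_neg (by positivity) ht
  rw [← h₁ t ht x, ← h₂ (m₁ ^ 2 * t) ht' (m₁ • S₁ x)]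
  have e1 : (m₁ * m₂) ^ 2 * t = m₂ ^ 2 * (m₁ ^ 2 * t) := by ring
  have e2 : (m₁ * m₂) • (S₁.trans S₂) x = m₂ • S₂ (m₁ • S₁ x) := by
    rw [LinearIsometryEquiv.trans_apply, map_smul, smul_smul, mul_comm]
  rw [e1, e2, LinearIsometryEquiv.symm_trans, LinearIsometryEquiv.trans_apply]
  conv_rhs => rw [map_smul, smul_smul]

/-- **Inverse invariance.**  If `w` is invariant on `t < 0` under `(m, S)` with `m > 0`, it is invariant under
`(m⁻¹, S⁻¹)`. [folklore] -/
theorem rdssInv_symm {m : ℝ} (hm : 0 < m) (S : EuclideanSpace ℝ (Fin 3) ≃ₗᵢ[ℝ] EuclideanSpace ℝ (Fin 3))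
    (h : ∀ t < (0 : ℝ), ∀ x : EuclideanSpace ℝ (Fin 3), m • S.symm (w (m ^ 2 * t) (m • S x)) = w t x) :
    ∀ t < (0 : ℝ), ∀ x : EuclideanSpace ℝ (Fin 3),
      m⁻¹ • S.symm.symm (w (m⁻¹ ^ 2 * t) (m⁻¹ • S.symm x)) = w t x := by
  intro t ht x
  have hm0 : m ≠ 0 := hm.ne'
  have ht' : m⁻¹ ^ 2 * t < 0 := mul_neg_of_pos_of_neg (by positivity) ht
  have key := h (m⁻¹ ^ 2 * t) ht' (m⁻¹ • S.symm x)
  have e1 : m ^ 2 * (m⁻¹ ^ 2 * t) = t := by field_simp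
  have e2 : m • S (m⁻¹ • S.symm x) = x := by
    rw [map_smul, LinearIsometryEquiv.apply_symm_apply, smul_smul, mul_inv_cancel₀ hm0, one_smul]
  rw [e1, e2] at key
  rw [← key, LinearIsometryEquiv.symm_symm, map_smul, LinearIsometryEquiv.apply_symm_apply, smul_smul,
    inv_mul_cancel₀ hm0, one_smul]

/-- **All integer powers.**  If `w` is invariant on `t < 0` under `(l, R)`, `l > 0`, then for every `k ∈ ℤ` there is an
isometry `S` (a power of `R`) such that `w` is invariant under `(l^k, S)`. [folklore] -/
theorem exists_rdssInv_zpow {l : ℝ} (hl : 0 < l) (R : EuclideanSpace ℝ (Fin 3) ≃ₗᵢ[ℝ] EuclideanSpace ℝ (Fin 3))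
    (hinv : ∀ t < (0 : ℝ), ∀ x : EuclideanSpace ℝ (Fin 3), l • R.symm (w (l ^ 2 * t) (l • R x)) = w t x) (k : ℤ) :
    ∃ S : EuclideanSpace ℝ (Fin 3) ≃ₗᵢ[ℝ] EuclideanSpace ℝ (Fin 3),
      ∀ t < (0 : ℝ), ∀ x : EuclideanSpace ℝ (Fin 3), (l ^ k) • S.symm (w ((l ^ k) ^ 2 * t) ((l ^ k) • S x)) = w t x := by
  induction k using Int.induction_on with
  | zero =>
    refine ⟨LinearIsometryEquiv.refl ℝ (EuclideanSpace ℝ (Fin 3)), fun t _ x => ?_⟩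
    simp only [zpow_zero, one_smul, one_pow, one_mul]
    rfl
  | succ i ih =>
    obtain ⟨S, hS⟩ := ih
    refine ⟨S.trans R, fun t ht x => ?_⟩
    have h := rdssInv_comp (zpow_pos hl _) S R hS hinv t ht x
    rwa [← zpow_add_one₀ hl.ne'] at h
  | pred i ih =>
    obtain ⟨S, hS⟩ := ih
    refine ⟨S.trans R.symm, fun t ht x => ?_⟩
    have h := rdssInv_comp (zpow_pos hl _) S R.symm hS (rdssInv_symm hl R hinv) t ht x
    rwa [← zpow_sub_one₀ hl.ne'] at h

/-! ### The change of variables behind (2.4), with a rotation -/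

/-- **The change of variables on an `S`-invariant product set.**  Let `w` be invariant on `t < 0` under `(γ, S)`,
`γ > 0`, let `I ⊆ (−∞, 0)` and `D ⊆ ℝ³` be measurable with `S⁻¹(D) = D`, and `q > 0`.  Then
`∫∫_{Φ_γ⁻¹(I × D)} ‖w‖^q = γ^{q−5} ∫∫_{I × D} ‖w‖^q`, `Φ_γ(t, x) = (γ² t, γ x)`: on the preimage
`‖w(t,x)‖ = γ ‖w(γ²t, γ S x)‖`, the rotation `(t,x) ↦ (t, S x)` preserves Lebesgue measure and the preimage set, and
`Φ_γ` has Jacobian `γ⁵` (Chae–Wolf 2017, (2.4), written for a rotated similarity). [cite: ChaeWolf2017RemovingDSS, §2 Step 3, (2.4) (arXiv p. 6)] -/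
theorem setLIntegral_rpow_enorm_rdss_preimage {γ : ℝ} (hγ : 0 < γ)
    (S : EuclideanSpace ℝ (Fin 3) ≃ₗᵢ[ℝ] EuclideanSpace ℝ (Fin 3))
    (h : ∀ t < (0 : ℝ), ∀ x : EuclideanSpace ℝ (Fin 3), γ • S.symm (w (γ ^ 2 * t) (γ • S x)) = w t x)
    {I : Set ℝ} (hI : I ⊆ Iio 0) (hIm : MeasurableSet I) {D : Set (EuclideanSpace ℝ (Fin 3))}
    (hDm : MeasurableSet D) (hD : S ⁻¹' D = D) {q : ℝ} (hq : 0 < q) :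
    ∫⁻ z in stAffine (γ ^ 2) γ 0 (0 : EuclideanSpace ℝ (Fin 3)) ⁻¹' (I ×ˢ D), ‖w z.1 z.2‖ₑ ^ q =
      ENNReal.ofReal (γ ^ (q - 5)) * ∫⁻ z in I ×ˢ D, ‖w z.1 z.2‖ₑ ^ q := by
  have hγ2 : 0 < γ ^ 2 := by positivity
  set Φ : ℝ × EuclideanSpace ℝ (Fin 3) → ℝ × EuclideanSpace ℝ (Fin 3) :=
    stAffine (γ ^ 2) γ 0 (0 : EuclideanSpace ℝ (Fin 3)) with hΦ
  set ψ : ℝ × EuclideanSpace ℝ (Fin 3) → ℝ × EuclideanSpace ℝ (Fin 3) :=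
    Prod.map (id : ℝ → ℝ) (S : EuclideanSpace ℝ (Fin 3) → EuclideanSpace ℝ (Fin 3)) with hψ
  set F : ℝ × EuclideanSpace ℝ (Fin 3) → ℝ≥0∞ := fun z => ‖w z.1 z.2‖ₑ ^ q with hF
  have hTm : MeasurableSet (Φ ⁻¹' (I ×ˢ D)) :=
    (hIm.prod hDm).preimage (continuous_stAffine (γ ^ 2) γ 0 (0 : EuclideanSpace ℝ (Fin 3))).measurable
  -- the rotation preserves the preimage set
  have hψT : ψ ⁻¹' (Φ ⁻¹' (I ×ˢ D)) = Φ ⁻¹' (I ×ˢ D) := by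
    ext ⟨t, x⟩
    simp only [hψ, hΦ, mem_preimage, Prod.map_apply, id_eq, stAffine_apply, mem_prod, zero_add]
    constructor
    · rintro ⟨h1, h2⟩
      refine ⟨h1, ?_⟩
      have : S (γ • x) ∈ D := by rwa [map_smul]
      have this' : γ • x ∈ S ⁻¹' D := this
      rwa [hD] at this'
    · rintro ⟨h1, h2⟩
      refine ⟨h1, ?_⟩
      have this' : γ • x ∈ S ⁻¹' D := by rwa [hD]
      have : S (γ • x) ∈ D := this'
      rwa [map_smul] at this
  -- Step 1: the pointwise identity on the preimage set
  have hpt : ∀ z ∈ Φ ⁻¹' (I ×ˢ D), F z = ENNReal.ofReal γ ^ q * (F ∘ Φ) (ψ z) := by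
    rintro ⟨t, x⟩ hz
    simp only [hΦ, mem_preimage, stAffine_apply, mem_prod, zero_add] at hz
    have ht : t < 0 := by
      have h1 : γ ^ 2 * t < 0 := hI hz.1
      nlinarith
    have key := h t ht x
    simp only [hF, hΦ, hψ, comp_apply, Prod.map_apply, id_eq, stAffine_apply, zero_add]
    rw [← key, enorm_smul, Real.enorm_eq_ofReal hγ.le, ENNReal.mul_rpow_of_nonneg _ _ hq.le]
    congr 2
    rw [enorm_eq_nnnorm, enorm_eq_nnnorm, LinearIsometryEquiv.nnnorm_map]
  -- Step 2: integrate, rotate, rescale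
  have hmp : MeasurePreserving ψ (volume : Measure (ℝ × EuclideanSpace ℝ (Fin 3))) volume :=
    measurePreserving_prodMap_id_linearIsometryEquiv S
  have hemb : MeasurableEmbedding ψ := measurableEmbedding_prodMap_id_linearIsometryEquiv S
  calc ∫⁻ z in Φ ⁻¹' (I ×ˢ D), F z
      = ∫⁻ z in Φ ⁻¹' (I ×ˢ D), ENNReal.ofReal γ ^ q * (F ∘ Φ) (ψ z) := setLIntegral_congr_fun hTm hpt
    _ = ENNReal.ofReal γ ^ q * ∫⁻ z in Φ ⁻¹' (I ×ˢ D), (F ∘ Φ) (ψ z) := by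
        rw [lintegral_const_mul' _ _ (ENNReal.rpow_ne_top_of_nonneg hq.le ENNReal.ofReal_ne_top)]
    _ = ENNReal.ofReal γ ^ q * ∫⁻ z in Φ ⁻¹' (I ×ˢ D), (F ∘ Φ) z := by
        congr 1
        conv_lhs => rw [← hψT]
        exact hmp.setLIntegral_comp_preimage_emb hemb (F ∘ Φ) _
    _ = ENNReal.ofReal γ ^ q * (ENNReal.ofReal (γ ^ 2 * γ ^ 3)⁻¹ * ∫⁻ z in I ×ˢ D, F z) := by
        congr 1
        have h2 := setLIntegral_preimage_comp_stAffine hγ2 hγ 0 (0 : EuclideanSpace ℝ (Fin 3)) F (I ×ˢ D)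
        rw [finrank_euclideanSpace_fin] at h2
        exact h2
    _ = ENNReal.ofReal (γ ^ (q - 5)) * ∫⁻ z in I ×ˢ D, F z := by
        rw [← mul_assoc]
        congr 1
        rw [ENNReal.ofReal_rpow_of_pos hγ, ← ENNReal.ofReal_mul (Real.rpow_nonneg hγ.le _)]
        congr 1
        rw [Real.rpow_sub hγ, div_eq_mul_inv]
        congr 2
        rw [← pow_add]
        norm_num

/-! ### The weighted Serrin estimate (2.5) for RDSS fields -/

/-- The dyadic annuli `D_k = {c⁻ᵏ ≤ |y| < c^{1−k}}` are invariant under every linear isometry. [folklore] -/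
theorem preimage_isometry_annulus (S : EuclideanSpace ℝ (Fin 3) ≃ₗᵢ[ℝ] EuclideanSpace ℝ (Fin 3)) (a b : ℝ) :
    S ⁻¹' {y : EuclideanSpace ℝ (Fin 3) | a ≤ ‖y‖ ∧ ‖y‖ < b} = {y | a ≤ ‖y‖ ∧ ‖y‖ < b} := by
  ext y
  simp only [mem_preimage, mem_setOf_eq, LinearIsometryEquiv.norm_map]

/-- **Chae–Wolf 2017, (2.5), for rotated discrete self-similarity.**  Let `w : ℝ → ℝ³ → ℝ³` be invariant on `t < 0`
under the similarities `(c^k, S_k)` for all `k ∈ ℤ` (some isometries `S_k`; e.g. the powers of one RDSS invariance,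
`exists_rdssInv_zpow`), `c > 1`, and `q > 0`.  Then
`∫_{−∞}^0 ∫_{1 ≤ |x| < c} ‖w‖^q (−t)^{(q−5)/2} ≤ max(1, c^{q−5}) ∫_{−c²}^{−1} ∫_{ℝ³} ‖w‖^q` (in `ℝ≥0∞`).  Proof as printed
and as in the tree's pure-DSS `ChaeWolfDecay.lintegral_weighted_annulus_le`: split `(−∞,0)` into the blocks `B_k`, bound
the weight on each block, change variables with the pair `(c^{−k}, S_{−k})` (`setLIntegral_rpow_enorm_rdss_preimage` +
`ChaeWolfDecay.preimage_stAffine_baseBlock`), and resum the disjoint annuli. [cite: ChaeWolf2017RemovingDSS, §2 Step 3, (2.3)–(2.5) (arXiv p. 6)] -/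
theorem lintegral_weighted_annulus_le_rdss {c : ℝ} (hc : 1 < c)
    (hfam : ∀ k : ℤ, ∃ S : EuclideanSpace ℝ (Fin 3) ≃ₗᵢ[ℝ] EuclideanSpace ℝ (Fin 3),
      ∀ t < (0 : ℝ), ∀ x : EuclideanSpace ℝ (Fin 3), (c ^ k) • S.symm (w ((c ^ k) ^ 2 * t) ((c ^ k) • S x)) = w t x)
    {q : ℝ} (hq : 0 < q) :
    ∫⁻ z in Iio (0 : ℝ) ×ˢ {x : EuclideanSpace ℝ (Fin 3) | 1 ≤ ‖x‖ ∧ ‖x‖ < c},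
        ‖w z.1 z.2‖ₑ ^ q * ENNReal.ofReal ((-z.1) ^ ((q - 5) / 2)) ≤
      ENNReal.ofReal (max 1 (c ^ (q - 5))) *
        ∫⁻ z in Ioc (-c ^ 2) (-1) ×ˢ (univ : Set (EuclideanSpace ℝ (Fin 3))), ‖w z.1 z.2‖ₑ ^ q := by
  have hc0 : 0 < c := one_pos.trans hc
  set M : ℝ := max 1 (c ^ (q - 5)) with hM
  have hM0 : 0 ≤ M := le_trans zero_le_one (le_max_left _ _)
  -- notation for the sets
  set A₁ : Set (EuclideanSpace ℝ (Fin 3)) := {x | 1 ≤ ‖x‖ ∧ ‖x‖ < c} with hA₁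
  set B : ℤ → Set ℝ := fun k => Ioc (-(c ^ 2) ^ (k + 1)) (-(c ^ 2) ^ k) with hB
  set D : ℤ → Set (EuclideanSpace ℝ (Fin 3)) := fun k =>
    {y | c ^ (-k) ≤ ‖y‖ ∧ ‖y‖ < c * c ^ (-k)} with hD
  set g : ℝ × EuclideanSpace ℝ (Fin 3) → ℝ≥0∞ := fun z => ‖w z.1 z.2‖ₑ ^ q with hg
  -- Step 1: split the time axis into blocks
  have hS : Iio (0 : ℝ) ×ˢ A₁ = ⋃ k : ℤ, B k ×ˢ A₁ := by
    rw [← iUnion_prod_const, ChaeWolfDecay.iUnion_timeBlock hc]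
  have hSm : ∀ k, MeasurableSet (B k ×ˢ A₁) := fun k =>
    measurableSet_Ioc.prod (ChaeWolfDecay.measurableSet_annulus 1 c)
  have hSd : Pairwise (Disjoint on fun k : ℤ => B k ×ˢ A₁) := fun i j hij =>
    Set.disjoint_prod.2 (Or.inl (ChaeWolfDecay.pairwise_disjoint_timeBlock hc hij))
  rw [hS, lintegral_iUnion hSm hSd]
  -- Step 2: the bound on each block
  have hIoc : Ioc (-c ^ 2) (-1) ⊆ Iio (0 : ℝ) := fun t ht => lt_of_le_of_lt ht.2 (by norm_num)
  have hblock_eq : ∀ k : ℤ, ∫⁻ z in B k ×ˢ A₁, g z =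
      ENNReal.ofReal ((c ^ (-k)) ^ (q - 5)) * ∫⁻ z in Ioc (-c ^ 2) (-1) ×ˢ D k, g z := by
    intro k
    obtain ⟨S, hS⟩ := hfam (-k)
    have hγ0 : 0 < c ^ (-k) := zpow_pos hc0 _
    have key := setLIntegral_rpow_enorm_rdss_preimage hγ0 S hS hIoc measurableSet_Ioc
      (ChaeWolfDecay.measurableSet_annulus _ _) (preimage_isometry_annulus S _ _) hq (D := D k)
    rwa [ChaeWolfDecay.preimage_stAffine_baseBlock hc k] at key
  have hblock : ∀ k : ℤ, ∫⁻ z in B k ×ˢ A₁, g z * ENNReal.ofReal ((-z.1) ^ ((q - 5) / 2)) ≤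
      ENNReal.ofReal M * ∫⁻ z in Ioc (-c ^ 2) (-1) ×ˢ D k, g z := by
    intro k
    have hg0k : 0 < (c ^ 2) ^ k := zpow_pos (by positivity) k
    set W : ℝ := M * ((c ^ 2) ^ k) ^ ((q - 5) / 2) with hW
    -- pointwise weight bound on the block
    have h1 : ∫⁻ z in B k ×ˢ A₁, g z * ENNReal.ofReal ((-z.1) ^ ((q - 5) / 2)) ≤
        ∫⁻ z in B k ×ˢ A₁, ENNReal.ofReal W * g z := by
      refine lintegral_mono_ae ((ae_restrict_mem (hSm k)).mono fun z hz => ?_)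
      rw [mul_comm]
      exact mul_le_mul' (ENNReal.ofReal_le_ofReal (ChaeWolfDecay.weight_le_on_timeBlock hc k q hz.1)) le_rfl
    rw [lintegral_const_mul' _ _ ENNReal.ofReal_ne_top, hblock_eq k, ← mul_assoc,
      ← ENNReal.ofReal_mul (by rw [hW]; positivity)] at h1
    have h2 : W * (c ^ (-k)) ^ (q - 5) = M := by
      rw [hW, mul_assoc, ChaeWolfDecay.block_factors_cancel hc k q, mul_one]
    rwa [h2] at h1
  -- Step 3: resum
  calc ∑' k : ℤ, ∫⁻ z in B k ×ˢ A₁, g z * ENNReal.ofReal ((-z.1) ^ ((q - 5) / 2))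
      ≤ ∑' k : ℤ, ENNReal.ofReal M * ∫⁻ z in Ioc (-c ^ 2) (-1) ×ˢ D k, g z :=
        ENNReal.tsum_le_tsum hblock
    _ = ENNReal.ofReal M * ∑' k : ℤ, ∫⁻ z in Ioc (-c ^ 2) (-1) ×ˢ D k, g z := ENNReal.tsum_mul_left
    _ = ENNReal.ofReal M * ∫⁻ z in ⋃ k : ℤ, Ioc (-c ^ 2) (-1) ×ˢ D k, g z := by
        rw [lintegral_iUnion (fun k => measurableSet_Ioc.prod (ChaeWolfDecay.measurableSet_annulus _ _))
          (fun i j hij => Set.disjoint_prod.2 (Or.inr (ChaeWolfDecay.pairwise_disjoint_annulus hc hij)))]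
    _ ≤ ENNReal.ofReal M * ∫⁻ z in Ioc (-c ^ 2) (-1) ×ˢ (univ : Set (EuclideanSpace ℝ (Fin 3))), g z := by
        refine mul_le_mul' le_rfl (lintegral_mono_set ?_)
        exact iUnion_subset fun k => prod_mono Subset.rfl (subset_univ _)

/-! ### From the period strip to the strip of the squared similarity -/

/-- Preimage of the strip `(−c², −1] × ℝ³` under `Φ_{c⁻¹}` is `(−c⁴, −c²] × ℝ³` (`c ≠ 0`). [folklore] -/
theorem preimage_stAffine_inv_strip {c : ℝ} (hc : 0 < c) :
    stAffine ((c⁻¹) ^ 2) c⁻¹ 0 (0 : EuclideanSpace ℝ (Fin 3)) ⁻¹'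
        (Ioc (-c ^ 2) (-1) ×ˢ (univ : Set (EuclideanSpace ℝ (Fin 3)))) =
      Ioc (-(c ^ 2) ^ 2) (-c ^ 2) ×ˢ (univ : Set (EuclideanSpace ℝ (Fin 3))) := by
  have hc2 : 0 < c ^ 2 := by positivity
  ext ⟨t, x⟩
  simp only [mem_preimage, stAffine_apply, zero_add, mem_prod, mem_Ioc, mem_univ, and_true, inv_pow]
  rw [inv_mul_eq_div, lt_div_iff₀ hc2, div_le_iff₀ hc2]
  constructor
  · rintro ⟨h1, h2⟩; exact ⟨by nlinarith, by nlinarith⟩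
  · rintro ⟨h1, h2⟩; exact ⟨by nlinarith, by nlinarith⟩

/-- **Finiteness on the strip of the squared similarity.**  If `w` is invariant on `t < 0` under `(c, R)`, `c > 1`, and
`∫∫_{(−c²,−1] × ℝ³} ‖w‖^q < ∞` (`q > 0`), then `∫∫_{(−c⁴,−1] × ℝ³} ‖w‖^q < ∞` (the extra strip `(−c⁴, −c²]` is the
image of the period strip under the inverse similarity `(c⁻¹, R⁻¹)`). [cite: ChaeWolf2017RemovingDSS, §2 Step 3 (arXiv p. 6)] -/
theorem lintegral_strip_sq_lt_top_of_rdss {c : ℝ} (hc : 1 < c)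
    (R : EuclideanSpace ℝ (Fin 3) ≃ₗᵢ[ℝ] EuclideanSpace ℝ (Fin 3))
    (hinv : ∀ t < (0 : ℝ), ∀ x : EuclideanSpace ℝ (Fin 3), c • R.symm (w (c ^ 2 * t) (c • R x)) = w t x)
    {q : ℝ} (hq : 0 < q)
    (hfin : ∫⁻ z in Ioc (-c ^ 2) (-1) ×ˢ (univ : Set (EuclideanSpace ℝ (Fin 3))), ‖w z.1 z.2‖ₑ ^ q < ⊤) :
    ∫⁻ z in Ioc (-(c ^ 2) ^ 2) (-1) ×ˢ (univ : Set (EuclideanSpace ℝ (Fin 3))), ‖w z.1 z.2‖ₑ ^ q < ⊤ := by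
  have hc0 : 0 < c := one_pos.trans hc
  have hc2 : 1 < c ^ 2 := by nlinarith
  -- the extra strip
  have hinv' := rdssInv_symm hc0 R hinv
  have hextra : ∫⁻ z in Ioc (-(c ^ 2) ^ 2) (-c ^ 2) ×ˢ (univ : Set (EuclideanSpace ℝ (Fin 3))),
      ‖w z.1 z.2‖ₑ ^ q < ⊤ := by
    have key := setLIntegral_rpow_enorm_rdss_preimage (inv_pos.2 hc0) R.symm hinv'
      (fun t ht => lt_of_le_of_lt ht.2 (by norm_num)) measurableSet_Ioc MeasurableSet.univ
      (preimage_univ) hq (I := Ioc (-c ^ 2) (-1))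
    rw [preimage_stAffine_inv_strip hc0] at key
    rw [key]
    exact ENNReal.mul_lt_top ENNReal.ofReal_lt_top hfin
  -- union of the two strips
  have hU : Ioc (-(c ^ 2) ^ 2) (-1) ×ˢ (univ : Set (EuclideanSpace ℝ (Fin 3))) =
      Ioc (-(c ^ 2) ^ 2) (-c ^ 2) ×ˢ (univ : Set (EuclideanSpace ℝ (Fin 3))) ∪
        Ioc (-c ^ 2) (-1) ×ˢ (univ : Set (EuclideanSpace ℝ (Fin 3))) := by
    rw [← union_prod, Ioc_union_Ioc_eq_Ioc (by nlinarith) (by nlinarith)]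
  rw [hU]
  refine lt_of_le_of_lt (lintegral_union_le _ _ _) ?_
  exact ENNReal.add_lt_top.2 ⟨hextra, hfin⟩

end Summit.NavierStokesRegularity.NavierStokesRegularity.Theorems.SymmetryModuliCountForcedSymmetry

end
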